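import Summits.AtomisticToContinuum.Crystallization.Theorems.FluxTubeKeplerFloorGivesLayered
import Summits.AtomisticToContinuum.Crystallization.Theorems.FluxTubeKeplerFluxCellKeplerSingleScale
import Summits.AtomisticToContinuum.Crystallization.Theorems.ChessboardParticlePlanesPeriodicWindowsIffCrystallization

/-!
# G23 banked candidate (NOT a registered line) — the ANTIPODAL-BLIND ladder `ARung t` over `FluxTubeKepler.FloorGivesLayered`

Forward generator G1 (gen 23), seed `g1-AtomisticToContinuum-15223` =
`FluxTubeKeplerFloorGivesLayered.FloorGivesLayered_proof` (the FLOOR), crux dir `FluxCellKepler`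
(stmt-AtomisticToContinuum-15221).  OUTCOME OF THE SEAT: `critic-rejected` / found-nothing — this file
only BANKS the best typed candidate so that it is machine-harvestable (F7).  It is NOT filed as a line
(§Verdict).

THE DIAL.  The floor: FLOOR(P₀) (`N·e(P₀) ≤ E(x)` on Lennard-Jones ground states) + BUDGET(P₀) (at every
scale `(R, η)` some `c > 0` with `c · #{(R, η)-bad sites} ≤ E(x) − N·e(P₀)` on ground states) ⇒ layered,
hence periodic, windows along every ground-state sequence.  Here the budget is ANTIPODAL-BLIND with
tolerance dial `t ≥ 0`: an `(R, η)`-bad site `i` whose relative `R`-cluster `{x j − x i : ‖x j − x i‖ ≤ R}`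
is `tη`-CENTRALLY SYMMETRIC about the site (every `x j − x i` in the ball has some `x k − x i` within `tη`
of `−(x j − x i)`) goes UN-PRICED; only the bad-and-asymmetric sites are priced.  `t = 0` un-prices
nothing (`Antipodal 0` is `False` by its first conjunct): `ARung 0` IS the floor (`aRung_zero`, F3).  The
family is monotone (`aRung_mono`: raising `t` un-prices more sites, the rung gets stronger).  Banked
candidate: `AntipodalBlindRung := ARung 1` — "a certificate that never prices a locally centrosymmetric
site (bcc-, simple-cubic-, any-Bravais-lattice-like chunks, icosahedral CENTRES, …) already forces periodic
windows".  The axis (a point-SYMMETRY class of the local cluster) is not among the registered dials gens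
1–16, 18, 21 nor the censused candidates G17 A–I, G20 J–W, G22 X1–X12.

ON PATH (F4): `Crystallization → ARung t` for every `t` (`aRung_of_crystallization`, through the landed
`periodicWindows_of_crystallization`), hence `AntipodalBlindRung_of_Crystallization`.

§Verdict (why it is not filed).
(1) RESTORING SIDE IS GEN 8 PLUS ONE GEOMETRIC LEMMA.  A Delone set all of whose `2R_cov`-clusters are
centrally symmetric is globally antipodal and hence a disjoint union of `< 2³` parallel translates of one lattice
(Dolbilin–Magazinov 2015/16; Dolbilin, *Delone sets: local identity and global symmetry*, arXiv:1608.06842, Thm 3).  So a window in which every site is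
un-priced and no site is layered-good is (approximately) PERIODIC-GOOD of complexity `(8, L₀, ρ₀)` in the
sense of the registered gen-8 line `Lines/CompetitorBlindRung.lean` (`PerGood`), and the rung would follow
from that line's two potential-free stubs (`stub_cellCompact`, `stub_perWindows`) plus the approximate
local-antipodality rigidity `AntipodalToPeriodic` below plus a ball-occupancy/covering count — a
recombination (gen 8 ∘ Dolbilin–Magazinov), not a new lever; and "local rule ⇒ global crystal" is already
the lever of the open routes `IsometryAtoms` (multiregular / Bieberbach) and `SumsetDoublingRigidity`.
(2) CERTIFICATE SIDE: RELIEF IS ONLY QUANTITATIVE.  In an amorphous / polytetrahedral competitor the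
centrosymmetric sites (icosahedral centres, lattice-like grains) are a fraction bounded away from `1` of all
sites at the first-shell scale and essentially none at large scales, so a certificate meeting the
antipodal-blind budget must still prove `E(glass) − N·e⋆ ≥ c·N` for the same amorphous states as the
floor's budget — `Literature.Barriers.AtomisticToContinuum.TetrahedralFrustration` head-on, with a better
constant only.  (This is the general closure fact recorded in `Lines/G23FoundNothing.md`: an un-priced class
either is forced periodic/layered by local geometry (⇒ covered by gens 4/5/8/9/13), or is coverable by
priced sites (⇒ flat), or swallows whole amorphous states (⇒ summit-hard); relief is never qualitative.)
-/

noncomputable section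

namespace Summit.AtomisticToContinuum.Crystallization.Cruxes.FluxCellKepler.AntipodalLadder

open Filter Topology
open Literature.MathematicalPhysics.StatisticalMechanics
open Summit.AtomisticToContinuum.Crystallization.Theorems.FluxCellKeplerSingleScale (LayeredGood)

local notation "E3" => EuclideanSpace ℝ (Fin 3)

/-! ## The graded family -/

/-- FLOOR(P₀): `N·e(P₀) ≤ E(x)` for every Lennard-Jones ground state `x` (verbatim the first hypothesis
of `FluxTubeKepler.FloorGivesLayered`). -/
def Floor (P₀ : PeriodicConfiguration 3) : Prop :=
  ∀ (N : ℕ) (x : Fin N → E3), IsGroundState lennardJones x →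
    (N : ℝ) * P₀.energyPerParticle lennardJones ≤ interactionEnergy lennardJones x

/-- Site `i` of `x` is `(R, η)`-ANTIPODAL with tolerance dial `t`: `0 < t` and the relative `R`-cluster of
`i` is `tη`-centrally symmetric about the site. (`t = 0` makes the class empty.) -/
def Antipodal (t R η : ℝ) {N : ℕ} (x : Fin N → E3) (i : Fin N) : Prop :=
  0 < t ∧ ∀ j : Fin N, ‖x j - x i‖ ≤ R → ∃ k : Fin N, dist (x k - x i) (-(x j - x i)) ≤ t * η

/-- ANTIPODAL-BLIND BUDGET(P₀) with dial `t`: at scale `(R, η)` only the sites that are NEITHER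
layered-good NOR `t`-antipodal are priced (the crux's quantifier order `∀ R η ∃ c`). -/
def Budget (t : ℝ) (P₀ : PeriodicConfiguration 3) : Prop :=
  ∀ R η : ℝ, 0 < R → 0 < η → ∃ c : ℝ, 0 < c ∧
    ∀ (N : ℕ) (x : Fin N → E3), IsGroundState lennardJones x →
      c * (Nat.card {i : Fin N // ¬ LayeredGood R η x i ∧ ¬ Antipodal t R η x i} : ℝ) ≤
        interactionEnergy lennardJones x - (N : ℝ) * P₀.energyPerParticle lennardJones

/-- Periodic windows along `x` (verbatim the conclusion of `ChessboardParticlePlanes.PeriodicWindows`). -/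
def HasPeriodicWindows (x : (N : ℕ) → (Fin N → E3)) : Prop :=
  ∃ P : PeriodicConfiguration 3, ∀ R ε : ℝ, 0 < ε → ∃ᶠ N in atTop, ∃ t : E3,
    (∀ s ∈ P.points, ‖s‖ ≤ R → ∃ i : Fin N, dist (x N i + t) s ≤ ε) ∧
    (∀ i : Fin N, ‖x N i + t‖ ≤ R → ∃ s ∈ P.points, dist (x N i + t) s ≤ ε)

/-- The graded family: FLOOR + the `t`-antipodal-blind budget force periodic windows along ground states. -/
def ARung (t : ℝ) : Prop :=
  ∀ P₀ : PeriodicConfiguration 3, Floor P₀ → Budget t P₀ →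
    ∀ x : (N : ℕ) → (Fin N → E3), (∀ N, IsGroundState lennardJones (x N)) → HasPeriodicWindows x

/-- **The banked candidate rung** (first natural member above the floor, tolerance = the matching
tolerance itself): a certificate that never prices a locally centrosymmetric site already forces periodic
windows along the ground states. -/
def AntipodalBlindRung : Prop := ARung 1

/-! ## The reduction that makes the candidate a recombination (documented, not proved) -/

/-- The point set `F + ℤb₀ + ℤb₁ + ℤb₂` of a cell datum (verbatim `Lines/CompetitorBlindRung.cellSet`). -/
def cellSet (b : Fin 3 → E3) (F : Finset E3) : Set E3 :=
  {p | ∃ y ∈ F, ∃ n : Fin 3 → ℤ, p = y + ∑ k, (n k : ℝ) • b k}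

/-- Admissible cell data of complexity `(m, L, ρ)` (verbatim `Lines/CompetitorBlindRung.IsCell`). -/
def IsCell (m : ℕ) (L ρ : ℝ) (b : Fin 3 → E3) (F : Finset E3) : Prop :=
  LinearIndependent ℝ b ∧ (∀ k, ‖b k‖ ≤ L) ∧ F.Nonempty ∧ F.card ≤ m ∧ (∀ y ∈ F, ‖y‖ ≤ 3 * L) ∧
    (∀ y ∈ F, ∀ y' ∈ F, (∃ n : Fin 3 → ℤ, y - y' = ∑ k, (n k : ℝ) • b k) → y = y') ∧
    (∀ p ∈ cellSet b F, ∀ q ∈ cellSet b F, p ≠ q → ρ ≤ dist p q)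

/-- `(R, η)`-periodic-good at complexity `(m, L, ρ)` (verbatim `Lines/CompetitorBlindRung.PerGood`). -/
def PerGood (m : ℕ) (L ρ R η : ℝ) {N : ℕ} (x : Fin N → E3) (i : Fin N) : Prop :=
  ∃ (b : Fin 3 → E3) (F : Finset E3), IsCell m L ρ b F ∧
    (∀ p ∈ cellSet b F, ‖p‖ ≤ R → ∃ j : Fin N, dist (x j - x i) p ≤ η) ∧
    (∀ j : Fin N, ‖x j - x i‖ ≤ R → ∃ p ∈ cellSet b F, dist (x j - x i) p ≤ η)

/-- **Approximate Dolbilin–Magazinov rigidity on ground states (the inclusion that places the candidate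
below gen 8's machinery; not proved here).**  For some fixed complexity `(8, L₀, ρ₀)`: at every target
scale `(R, η)` there is a finer probing scale `(R', η')` such that a ground-state site all of whose
`R'`-neighbours are un-priced at `(R', η')` (layered-good or `1`-antipodal) is itself layered-good or
periodic-good at `(R, η)`.  Exact version (`η' = 0`, no layered sites): a Delone set with centrally
symmetric `2R_cov`-clusters is a disjoint union of `< 2³` parallel translates of one lattice [arXiv:1608.06842, Thm 3]. -/
def AntipodalToPeriodic : Prop :=
  ∃ L₀ ρ₀ : ℝ, 0 < ρ₀ ∧ ∀ R η : ℝ, 0 < R → 0 < η → ∃ R' η' : ℝ, R ≤ R' ∧ 0 < η' ∧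
    ∀ (N : ℕ) (x : Fin N → E3) (i : Fin N), IsGroundState lennardJones x →
      (∀ j : Fin N, ‖x j - x i‖ ≤ R' → LayeredGood R' η' x j ∨ Antipodal 1 R' η' x j) →
        LayeredGood R η x i ∨ PerGood 8 L₀ ρ₀ R η x i

/-! ## Dial monotonicity -/

/-- The antipodal class grows with the tolerance dial (at `η ≥ 0`). -/
theorem antipodal_mono {t t' : ℝ} (h : t ≤ t') {R η : ℝ} (hη : 0 ≤ η) {N : ℕ} (x : Fin N → E3)
    (i : Fin N) : Antipodal t R η x i → Antipodal t' R η x i := by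
  rintro ⟨ht, hA⟩
  refine ⟨ht.trans_le h, fun j hj => ?_⟩
  obtain ⟨k, hk⟩ := hA j hj
  exact ⟨k, hk.trans (mul_le_mul_of_nonneg_right h hη)⟩

/-- A budget pricing the larger set prices the smaller one. -/
theorem budget_anti {t t' : ℝ} (h : t ≤ t') (P₀ : PeriodicConfiguration 3) :
    Budget t P₀ → Budget t' P₀ := by
  classical
  intro hB R η hR hη
  obtain ⟨c, hc, hcB⟩ := hB R η hR hη
  refine ⟨c, hc, fun N x hx => le_trans ?_ (hcB N x hx)⟩
  have hle : Nat.card {i : Fin N // ¬ LayeredGood R η x i ∧ ¬ Antipodal t' R η x i} ≤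
      Nat.card {i : Fin N // ¬ LayeredGood R η x i ∧ ¬ Antipodal t R η x i} := by
    rw [Nat.card_eq_fintype_card, Nat.card_eq_fintype_card]
    exact Fintype.card_subtype_mono _ _ fun i hi =>
      ⟨hi.1, fun hA => hi.2 (antipodal_mono h hη.le x i hA)⟩
  exact mul_le_mul_of_nonneg_left (by exact_mod_cast hle) hc.le

/-- `ARung` is MONOTONE in the tolerance dial: raising `t` un-prices more sites and strengthens the rung. -/
theorem aRung_mono {t t' : ℝ} (h : t ≤ t') : ARung t' → ARung t :=
  fun H P₀ hF hB x hx => H P₀ hF (budget_anti h P₀ hB) x hx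

/-! ## F3 — the family at `t = 0` is the proved floor -/

/-- At `t = 0` the antipodal class is empty. -/
theorem not_antipodal_zero (R η : ℝ) {N : ℕ} (x : Fin N → E3) (i : Fin N) : ¬ Antipodal 0 R η x i :=
  fun h => lt_irrefl 0 h.1

/-- **F3.** `ARung 0` — every bad site priced — is the seed `FloorGivesLayered_proof` followed by the
proved `PeriodicGivenLayered_holds`. [folklore] -/
theorem aRung_zero : ARung 0 := by
  intro P₀ hF hB x hx
  refine Theses.FluxTubeKepler.PeriodicGivenLayered_holds x hx
    (Theorems.FluxTubeKeplerFloorGivesLayered.FloorGivesLayered_proof P₀ hF ?_ x hx)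
  intro R η hR hη
  obtain ⟨c, hc, hcB⟩ := hB R η hR hη
  refine ⟨c, hc, fun N y hy => ?_⟩
  show c * (Nat.card {i : Fin N // ¬ LayeredGood R η y i} : ℝ) ≤ _
  simpa only [not_antipodal_zero, not_false_eq_true, and_true] using hcB N y hy

example : ARung 0 := aRung_zero

/-- Every member of the family gives the floor value back. -/
theorem aRung_zero_of_aRung {t : ℝ} (ht : 0 ≤ t) (h : ARung t) : ARung 0 :=
  aRung_mono ht h

theorem aRung_zero_of_antipodalBlindRung (h : AntipodalBlindRung) : ARung 0 :=
  aRung_zero_of_aRung zero_le_one h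

/-! ## F4 — on path: `Crystallization → ARung t` -/

/-- ON-PATH: the sub-problem implies every member of the family (landed hull-criterion converse). -/
theorem aRung_of_crystallization (t : ℝ) (h : _root_.Crystallization) : ARung t :=
  fun _ _ _ x hx =>
    Theorems.ChessboardParticlePlanesPeriodicWindowsIffCrystallization.periodicWindows_of_crystallization
      h x hx

/-- **F4 — `Crystallization → AntipodalBlindRung`.** -/
@[aesop safe apply]
theorem AntipodalBlindRung_of_Crystallization (h : _root_.Crystallization) : AntipodalBlindRung :=
  aRung_of_crystallization 1 h

end Summit.AtomisticToContinuum.Crystallization.Cruxes.FluxCellKepler.AntipodalLadder
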